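import Mathlib
import HarnessLib
import HarnessLib.Audit
import Summits.CriticalPhenomena.Statement
import Literature.MathematicalPhysics.QuantumLattice.LatticeScalarField
import Literature.MathematicalPhysics.QuantumLattice.EuclideanAction
import Literature.MathematicalPhysics.QuantumLattice.BallSpecification
import Literature.Probability.LatticeModels.GibbsSpecification
import HarnessLib.Audit.Status.Attr

/-!
Route: BallSpecification

# Route BallSpecification — Möbius = similarity + the ball forgets its centre — ball-DLR
specification of the critical field, punctured Gibbs uniqueness as the global engine

It suffices to show X = (A) ∧ (B) ∧ (D), realising card ball-specification-centre-blindness ("Möbius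
= similarity + the ball
forgets its centre"). (A) BallSpecifiedFieldLimit: the critical correlators on ℤ³ have a normalised,
non-degenerate,
Euclidean-invariant, scale-covariant pointwise scaling limit S that is CARRIED BY A FIELD LAW μ
(limit in law of the smeared
critical spin field, moments = S, invariant law) which is SPECIFIED ON BALLS: for every ball B(c,r)
a proper, exterior-measurable
kernel γ_{c,r}(·|η) versions μ( · | 𝓕_ext B) and is GERM-measurable on interior events (Markov
property across spheres) — the
continuum DLR structure (B1)+(E_field) of the card. (B) BallSpecifiedInversionUpgrade: every such
ball-specified limit is inversion
covariant (IsInversionCovariant Δ S) — the node the card's mechanism proves: Sim(3)-covariance of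
the kernels (free from the
invariant law) + (CB) CENTRE-BLINDNESS of the unit-ball kernel under Aut(B₁) ≅ PSL(2,ℂ) give LOCAL
Möbius covariance of the whole
ball family (Möb(3) = Sim(3)·Aut(B₁)); the inverted law ι_*μ, a law on distributions over ℝ³∖{0}, is
then Gibbs for the same
kernels on every ball whose closure avoids 0, and (PU) PUNCTURED GIBBS UNIQUENESS in the a-priori
class {E φ = 0, E φφ ≤ C·S₂}
forces ι_*μ = μ there, i.e. inversion covariance of S off the origin. (D) NonGaussianLimit = shared
item 0636 (clause (iii),
imported). Möbius covariance is then Euclid ∧ scale ∧ inversion (ConformalCovariance.lean).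
Lean: `BallSpecifiedFieldLimit ∧ BallSpecifiedInversionUpgrade ∧ NonGaussianLimit` (the three decls
below; full one-line terms under ## Cruxes, each elaborated in the planner's Sketch.lean, rc 0,
together with a sorry-free proof of the Assembly)

## Assembly
Pure logic (sorry-free in Sketch.lean, `assembly_holds`, five lines): take the witness (ρ, Δ, S, L,
μ, γ) of BallSpecifiedFieldLimit; BallSpecifiedInversionUpgrade applied to the same tuple gives
IsInversionCovariant Δ S; IsMoebiusCovariant Δ S := ⟨IsEuclideanInvariant S, IsScaleCovariant Δ S,
IsInversionCovariant Δ S⟩ (definition in ConformalCovariance.lean); NonGaussianLimit applied to (ρ,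
S) gives HasNontrivialU4 S; with ρ > 0, Δ > 0, the pointwise limit and non-degeneracy this is the
conjunct (root abbrev Ising3DConformalLimit = CritIsing3DConformalLimit).

Rationale: WHY THIS LINE. The global engine is the one hard theorem we own on ℤ³ at β_c: UNIQUENESS of the
critical Gibbs state (AizenmanDuminilCopinSidoraviciusCMP2015 Thm 1.2; in tree and PROVED:
hasUniqueGibbsMeasure_criticalBeta_holds) with Georgii's inheritance principle "a G-covariant
specification with a unique Gibbs measure has a G-invariant Gibbs measure" (FriedliVelenik2017 Thm
6.45/Cor 6.46, read pp. 298–300; Georgii2011 Ch. 5), transported to the continuum in the DLR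
formalism for Euclidean fields (GuerraRosenSimon1975; Rockner1986, specifications indexed by open
sets; AlbeverioHeghkrohnZegarlinski1989, uniqueness ⇒ global Markov/Euclidean consequences for
P(φ)₂) and indexed by BALLS, the Möbius-natural regions (Liouville/Carathéodory; LiouvilleRigidity
used positively). Two corrections to the card make the line well-posed and are this route's own
contribution: (1) Aut(B₁)∖O(3) moves ∞, so Möb(3) does not act on field configurations over ℝ³ and
Georgii's lemma cannot be applied verbatim — instead Sim-covariance + (CB) give LOCAL Möbius
covariance of the kernel family, and the global step becomes PUNCTURED uniqueness (ι_*μ and μ are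
both Gibbs for the kernels on balls avoiding 0), which compares two possibly mutually singular laws
— exactly what DLR uniqueness handles and absolute-continuity/Koopman upgrades cannot (card
quasi-invariance-is-invariance, N2–N3); (2) ball or half-space states with NICE boundary conditions
(+, free) plus GKS exhaustion never see the inversion (deep-bulk limits are reached through
hyperbolic isometries, i.e. through similarities to first order; worked out in NOTES.md: the
identity obtained is only S(ιx) = S(R_u ιx)), so the load-bearing object is the kernel on ROUGH
(μ-typical) exterior data — a specification, not a boundary CFT; BCFT centre-blindness
(CosmeLopesPenedones2015) is necessary, not sufficient. Imported areas: DLR/Gibbs-measure theory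
(probability), Möbius geometry of balls (Möb(3) = Sim(3)·Stab(B₁), 2-transitivity on S³),
Nelson–Markov structure of Euclidean fields (Nelson1973; AruPowell2022 Thm 2 is the Gaussian shadow:
ball-Markov + translations + scaling characterise the GFF). What prior routes do not do:
IsingEuclidUpgrade/HyperoctahedralRP carry the inversion as the bare upgrade (U)/item 1982; the
unrouted card markov-rigidity-locality-sigma-algebra bets on spectral/operator RIGIDITY of Markov
fields; here the inversion is split into a LOCAL kernel statement (CB) and a GLOBAL uniqueness
statement (PU) whose lattice seed is a theorem (support item LatticePuncturedUniqueness rests on the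
proved ADS uniqueness + FKG).

RANKED CRUXES. #2 BallSpecifiedInversionUpgrade (crux) — for every tuple (ρ, Δ, S, L, μ, γ) as in
BallSpecifiedFieldLimit — S a normalised (S = 0 off NonCoincident), non-degenerate,
Euclidean-invariant, scale-covariant pointwise scaling limit of criticalCorr 3, carried by a
probability law μ on FieldConfig ℝ³ (TendstoInLaw of isingFieldLaw 3 β_c along δ → 0⁺ with δ·L(δ) →
∞, HasMomentDensity μ S, Euclidean-invariant and scale-covariant LAW) that is specified on balls by
proper exterior-measurable kernels γ c r η, germ-measurable on interior events, with μ(A ∩ B) = ∫_B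
γ c r η A dμ for exterior events B — the family S is inversion covariant with the same Δ. (rev 2,
cone repair: hypotheses = the rev-2 body of BallSpecifiedFieldLimit verbatim, see #3.) Card items
(B4)+(CB)+(B2) fused into the one node they serve; intended proof = the card's mechanism with the
punctured-uniqueness global step (see ## Two-layer plan). Weaker demand than item 1982
InversionUpgradeNormalised (implied by it: Sketch.lean `upgrade_of_normalisedUpgrade`). [deps:
BallSpecifiedFieldLimit] [difficulty: open-problem] (why it might fail: (CB) centre-blindness has no
engine and may be as hard as inversion itself: a germ-Markov, RP, Euclidean, scale-covariant scalar
field that is not inversion covariant could exist (none known; Ising excluded only numerically, Δ_V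
> 5); (PU) must exclude all defect states at 0, ∞.) [FriedliVelenik2017, Georgii2011, AruPowell2022,
Rockner1986, AlbeverioHeghkrohnZegarlinski1989, DelamotteTissierWschebor2016,
CosmeLopesPenedones2015, Nakayama2015,
Literature.Barriers.CriticalPhenomena.ScaleCovarianceNotMoebius]
#3 BallSpecifiedFieldLimit (crux) — there exist ρ > 0 on (0,1], Δ > 0, S, box sides L with δ·L(δ) →
∞, a probability law μ on FieldConfig ℝ³ and ball kernels γ : ℝ³ → ℝ → FieldConfig ℝ³ → Measure
(FieldConfig ℝ³) such that: HasPointwiseScalingLimit (criticalCorr 3) ρ S, S = 0 off NonCoincident,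
IsNondegenerateTwoPoint S, IsEuclideanInvariant S, IsScaleCovariant Δ S; the smeared critical spin
fields isingFieldLaw 3 (criticalBeta 3) L δ ρ — rev 2 writes this out DEFINITIONALLY as spinFieldLaw
(isingMeasure (zdGraph 3) (box 3 (L δ)) β_c 0 plus) (box 3 (L δ)) δ (ρ δ), and IsScaleCovariantLaw μ
Δ as invariance of μ under the transpose of f ↦ s^(Δ−3) f(·/s) for all s > 0, so that
FieldScalingLimit.lean (home of the open fact Ising3DFieldScalingLimit and of
aizenman_fernandez_magnetization) leaves this route's import cone; rfl / simp-equivalences checked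
in the planner's SketchSanity.lean — converge in law to μ as δ → 0⁺, HasMomentDensity μ S,
IsEuclideanInvariantLaw μ, IsScaleCovariantLaw μ Δ; and (B1) μ is SPECIFIED ON BALLS (rev 2: written
over extEvents / germEvents / IsGibbsFor of
Literature/MathematicalPhysics/QuantumLattice/BallSpecification.lean, definitionally the rev-1
σ-algebras, and EVERY kernel clause now guarded by 0 < r as the route-review refuter asked — for r ≤
0 the unguarded clauses forced γ c r η = δ_η plus a Borel = cylinder-σ-algebra lemma unrelated to
Ising): each γ c r η is a probability measure, η ↦ γ c r η A is measurable for the exterior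
σ-algebra σ(ω f : tsupport f ⊆ (closedBall c r)ᶜ), for interior events A (generated by test
functions supported in the open ball) it is measurable for the exterior GERM σ-algebra ⋂_ε σ(ω f :
tsupport f ⊆ B(c,r+ε)∖B̄(c,r)) (Markov property across the sphere), γ c r η-a.e. ω = η on exterior
test functions (properness), and μ(A ∩ B) = ∫_B γ c r η A dμ for all measurable A and exterior
events B (DLR). Card items (E_field)+(B1); strictly stronger than items 1981/0638 (existence) by the
field carrier and the ball specification. [difficulty: open-problem] (why it might fail: Full δ→0⁺
existence is open on ℤ³ (ICM2022 §8.4); germ-Markov may not survive the limit: conditional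
independence is not weakly closed, an O(δ) shell could retain macroscopic information, or the σ-germ
may fail to generate the state on a sphere (ε-sector data).) [DuminilCopinICM2022,
AizenmanDuminilCopinAnnals2021, Nelson1973, AruPowell2022, GuerraRosenSimon1975,
Literature.Probability.LatticeModels.Ising3DFieldScalingLimit,
Literature.Barriers.CriticalPhenomena.PositionSpaceRGNonGibbsian]
#4 NonGaussianLimit (crux) — every non-degenerate pointwise scaling limit S of the renormalised
critical Ising correlators on ℤ³ has connected four-point function U₄ ≢ 0 on non-coincident
configurations — shared item stmt-CriticalPhenomena-0636 (IsingEuclidUpgrade r4 / HyperoctahedralRP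
(E)), written verbatim so that this route attaches; imported complement, not attacked here.
[difficulty: open-problem] (why it might fail: No proof that U₄ ≢ 0 in d = 3: the double-current
intersection probability at macroscopic separation must stay > 0 as δ → 0; RP long-range models ON
ℤ³ (α < 3/2) are Gaussian (LongRangeTrivialityOnZ3).) [AizenmanDuminilCopinAnnals2021,
DuminilCopinICM2022, Literature.Barriers.CriticalPhenomena.LongRangeTrivialityOnZ3]
#9 LatticePuncturedUniqueness (support) — lattice seed of the punctured-uniqueness step (PU), a
special case provable now on paper: every probability measure ν on spin configurations of ℤ³ that
satisfies the DLR equations of the critical Ising specification isingSpecification (zdGraph 3) β_c 0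
for all finite volumes Λ NOT containing the origin (the spin at 0 treated as environment — a point
defect) and has ⟨σ₀⟩_ν = 0 is a Gibbs measure for the full specification (hence THE critical state,
by hasUniqueGibbsMeasure_criticalBeta_holds). Paper proof: condition ν on σ₀ = s; ν(·|σ₀ = s) is
punctured-Gibbs with the 0-spin frozen, FKG-sandwiched between the ∓/± limits of the kernels on box
L ∖ {0}, which are the box-L minus/plus states conditioned on the cylinder {σ₀ = s}; these converge
to μ_{β_c}(·|σ₀ = s) by uniqueness (ADS15), since conditioning on a clopen local event of
probability → 1/2 commutes with the weak limit; so ν = p μ(·|+) + (1−p) μ(·|−), and ⟨σ₀⟩_ν = 0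
forces p = 1/2, ν = μ_{β_c}. "A point defect at criticality carries only its own spin." Tree inputs:
ising_fkg, hasBoxLimit_isingCorr_plus, hasUniqueGibbsMeasure_criticalBeta_holds,
isGibbsMeasure_iff_condExp. [difficulty: L] [FriedliVelenik2017,
AizenmanDuminilCopinSidoraviciusCMP2015, Georgii2011,
Literature.Probability.LatticeModels.hasUniqueGibbsMeasure_criticalBeta_holds]

TWO-LAYER PLAN. Foreseen glued splits (filed later by `route edit --split`, k ≤ 3, depth 1); both
definition requests have LANDED (see DEFINITION REQUESTS), so the children can now be typed.
BallSpecifiedInversionUpgrade ⇐ CentreBlindness → PuncturedUniqueness → (glue LocalMoebiusTransport)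
→ BallSpecifiedInversionUpgrade, where:
CentreBlindness (CB, the card's rank-2 content): μ admits a Sim(3)-covariant Feller VERSION of its
ball kernels whose unit-ball kernel is covariant under every Möbius automorphism T_a∘R of B₁ acting
with weight Δ on interior configurations and on exterior germs (equivalently: the kernel family is
covariant under the unit inversion on every ball whose closure avoids 0);
PuncturedUniqueness (PU): every law ν on distributions over ℝ³∖{0} with E_ν ω(f) = 0 and E_ν ω(f)² ≤
C·E_μ ω(f)² that satisfies the DLR equations for μ's kernels on all balls with closure in ℝ³∖{0}
equals μ restricted there (excludes charge-at-0 and harmonic-at-∞ states — the GFF check passes —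
and operator insertions at 0, which blow up like r^(−Δ_O) relative to S₂ by unitarity);
glue LocalMoebiusTransport (measure theory, provable once typed): Sim-covariance + CB ⇒ covariance
of γ under every (g, B) with g⁻¹∞ ∉ B̄ (Möb(3) = Sim(3)·Stab(B), conjugation; boosts of B₁ =
products of two inversions in spheres orthogonal to ∂B₁); hence ι_*μ is punctured-Gibbs for γ; PU ⇒
ι_*μ = μ on 𝒟'(ℝ³∖0); moments + continuity of S on NonCoincident ⇒ IsInversionCovariant Δ S.
BallSpecifiedFieldLimit ⇐ FieldLimitExists (E_field: items 1981/0638 plus the field carrier,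
shareable) → BallMarkovInheritance (the n.n. specification's exact Markov property across lattice
spheres, with its boundary-field kernel, passes to the limit as germ-measurable proper Feller ball
kernels) → BallSpecifiedFieldLimit.

KILL CRITERIA. B as typed is Ising-specific (hypothesis HasPointwiseScalingLimit (criticalCorr 3) +
normalisation), so a formal refutation of B is a non-inversion-covariant Ising limit and kills the
conjunct for every route. The informative kills are of the MECHANISM and close this route as a
strategy (close --reason exhausted with census, or pivot): (i) a germ-Markov, reflection-positive,
Euclidean-invariant, scale-covariant SCALAR random field on ℝ³ whose ball specification is
Sim-covariant but NOT centre-blind (a rigorous unitary 'SFT-not-CFT' with a ball specification) —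
then (CB) needs Ising-specific input nobody has: pivot to the NPR node of markov-rigidity or close;
(ii) a punctured-Gibbs law ν ≠ μ inside the a-priori class for ANY Möbius-covariant Markov field
(e.g. the d = 3 GFF) — refutes the PU design (restate the class or close); (iii) refutation of A —
e.g. a proof that the σ-field limit cannot be germ-Markov across spheres, or that no field carrier
has moment densities S — close --reason refuted:BallSpecifiedFieldLimit; (iv) refutation of
LatticePuncturedUniqueness would signal a typing error (it is a theorem on paper): restate at once.
Mooted: item 1982 (InversionUpgradeNormalised) proved elsewhere implies B; 0636 is shared; a proof
of Ising3DFieldScalingLimit plus Markov inheritance feeds A.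

NOT DECOMPOSED YET. (CB), (PU) and the transport glue are NOT items at open (they need the
definition requests: a ball-specification structure on FieldConfig with Feller regularity, and the
weight-Δ Möbius action on configurations/test functions supported off the pole); the Sim-covariant
Feller VERSION of the kernels (conditional probabilities are only a.e.-unique; the ∀-form of B is
robust to versions because its conclusion is about S only); continuity of S on NonCoincident
(locally uniform limit of lattice step functions whose oscillation → 0) and moment determinacy of μ;
the split of A into field existence + Markov inheritance; the 'uniqueness at ∞' half of (PU) versus
the lattice theorem hasUniqueGibbsMeasure_criticalBeta_holds (compact spins make the a-priori class
automatic on the lattice); any BCFT statement (centre-blindness of + or free ball states is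
necessary but carries no bulk-inversion information — NOTES.md dead end); clause (iii) (imported).

CHEAPEST FALSIFIER. (a) PAPER CHECK, one page: run the chain on the d = 3 massless GFF (Δ = 1/2) —
ball kernels = harmonic extension of the exterior germ + Dirichlet GFF (Markov, Feller,
Sim-covariant, centre-blind by the Kelvin transform); punctured uniqueness in {mean 0, covariance ≤
C|x−y|⁻¹}: a punctured-Gibbs ν is GFF + independent random harmonic h on ℝ³∖{0}; the charge a/|x|
dies by testing at scale r → 0 (a²r⁴ vs r⁵), harmonic polynomials incl. constants at scale R → ∞
(R^(2k+6) vs R⁵) — passes on paper; a surviving h shows the PU class is wrong. (b) ALREADY RUN: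
CosmeLopesPenedones2015 (arXiv:1503.02011): 1- and 2-point functions of critical 3D Ising in a FREE
ball are consistent with the ball-preserving special conformal maps (Δ_σ̃ = 1.276(2)); sharper
zero-shape-parameter test: bulk–boundary kernel K(z,b) ∝ (1−|z|²)^(Δ̂−Δ)|z−b|^(−2Δ̂), Δ = 0.5181, Δ̂
= 1.276 fixed (kit MC, radius 40) — failure kills conformal ball states, hence (CB). (c) THEORY: is
the descendant Δ:φ²: of the 3D GFF (RP, Euclidean, scale-covariant Δ = 3, NOT Möbius) germ-Markov in
its OWN filtration and ball-specified? If yes, 'ball-specified ⇒ centre-blind' dies as a class (B as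
typed survives, the strategy does not).

NUMBERS. Δ_σ = 0.5181489(10), Δ_ε = 1.412625(10) (PolandRychkovVichi2019 Table II);
ordinary-transition boundary spin dimension Δ̂ = 1.276(2) (CosmeLopesPenedones2015);
virial-candidate bound Δ_V > 5.0 (MenesesEtAl2019). Rigorous on ℤ³: Δ ∈ [1/2, 1] for any
scale-covariant non-degenerate limit (scalingDimension_mem_Icc_holds); |𝒢(β_c, 0)| = 1 for d ≥ 3
(hasUniqueGibbsMeasure_criticalBeta_holds, ADS15 Thm 1.2); the n.n. specification is Markov across
every lattice sphere with boundary-field kernel h_y(ξ) = β_c Σ_{z∼y, z∉Λ} ξ_z (isingSpecification).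
Group theory used: Sim(3) = Stab(∞) is maximal in Möb(3) (2-transitive action on S³), Aut(B₁) ∩
Sim(3) = O(3), Möb(3) = Sim(3)·Aut(B₁); ι(B(c,r)) = B(c/(|c|²−r²), r/(|c|²−r²)) for |c| > r; T_a(x)
= ((1−|a|²)(x−a) − |x−a|²a)/(1 − 2⟨a,x⟩ + |a|²|x|²) with conformal factor (1−|a|²)/(1 − 2⟨a,x⟩ +
|a|²|x|²) (= Poisson kernel on the sphere). Items at open: 5 (3 cruxes, 1 support, 1 assembly).

DEFINITION REQUESTS. STATUS (rev 2): BOTH LANDED — (1)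
Literature/MathematicalPhysics/QuantumLattice/BallSpecification.lean: extEvents U, germEvents c r,
shellTopology, structure IsBallSpecification γ (probability / exterior-measurable / Markov / proper
/ CONSISTENT, all for 0 < r), IsShellFeller γ good τ (Feller regularity relative to a good set and a
strong topology — the naive weak-* form is unsatisfiable, see that file's warning), IsGibbsFor γ ν U
(DLR on balls with closure in U; U = {0}ᶜ is the punctured condition of (PU)), IsBallSpecified μ;
items A/B (rev 2) use extEvents/germEvents/IsGibbsFor but deliberately NOT consistency (v) nor
Feller: those are properties of the GOOD VERSION of the kernels that the child CentreBlindness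
asserts to exist, not of the bare limit in A. Also landed: QuantumLattice/GermMarkov.lean
(IsGermMarkovLaw, shared with route MarkovRigidity items 6226/6227 — grounder suggestion: 5728 ⇐
6227-type glue) and (2) Literature/Probability/LatticeModels/MoebiusWeightedAction.lean
(moebiusWeightedAction, ballAut, ballAutFactor, ballAutChart, unitInversion, IsMoebiusImage,
isMoebiusImage_act_scaleTest). CONE CAVEAT for the tenure planner: MoebiusWeightedAction.lean
imports FieldScalingLimit.lean (only for scaleTest), so importing it for the CentreBlindness child
brings Ising3DFieldScalingLimit / aizenman_fernandez_magnetization back into this route's cone — ask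
(librarian/operator) for the fact-free definitions isingFieldLaw / scaleTest / IsScaleCovariantLaw
to be moved out of FieldScalingLimit.lean (or its open facts moved out) before that import, or state
the child over FieldConfig.act / dilateTest directly as items A/B now do. Original request text:
filed right after open (`ledger workitem add --kind definition … --for
<BallSpecifiedInversionUpgrade>`): (1) notion IsBallSpecification — for a law μ on FieldConfig E (E
= EuclideanSpace ℝ (Fin d)) and γ : E → ℝ → FieldConfig E → Measure (FieldConfig E): probability
kernels, exterior-measurable, proper on exterior test functions, consistent on nested balls,
interior events germ-measurable (Markov), FELLER (η ↦ γ c r η continuous for weak-* convergence of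
germs), DLR for μ; plus IsGibbsFor γ ν for laws ν on configurations over an open set U ⊆ E using
only balls with closure in U (punctured DLR) — topic Literature/MathematicalPhysics/QuantumLattice
(next to RandomField/EuclideanAction; Rockner1986 is the template). (2) notion moebiusWeightedAction
— for a Möbius map g of ℝᵈ ∪ {∞} (similarityPerm / inversionPerm words of ConformalCovariance.lean)
and Δ: the map f ↦ |det D(g⁻¹)|^((d−Δ)/d) · f∘g⁻¹ on Schwartz functions with tsupport in an open set
whose closure avoids the pole of g, as a SchwartzMap, its transpose on FieldConfig restricted to
such sets, and the explicit ball automorphisms T_a with their conformal factors — topic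
Literature/Probability/LatticeModels (ConformalCovariance). No cite facts requested now (FV Thm 6.45
is two lines; Georgii's local-modification equivalence of 𝒢 would only shorten the support item).

Novelty: Searches (2026-08-15): `lit search --hybrid "uniqueness Gibbs states Euclidean fields global Markov
property specification rotation invariance"` (12 held docs: FV2017, Grimmett RCM, Albeverio
St-Flour, Glimm–Jaffe …; FV pp. 298–300 then READ: Thm 6.45, Cor 6.46); `lit search --source zbmath`
×6: "uniqueness global Markov property Euclidean fields polynomial interactions" (3:
doi:10.1007/bf01418123 AHK 1979, doi:10.1007/bf01238808 AHKZ 1989, doi:10.1007/bf01208480),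
"specifications Martin boundaries random fields Röckner" (1: doi:10.1007/bf01210928),
"characterisation Gaussian free field domain Markov property scaling" (2: arXiv:2103.07273
Aru–Powell, arXiv:1909.05067), "Gibbs measures conformal invariance uniqueness critical" (1:
Grimmett RCM only), "Markov property Euclidean field theory spheres conformal group Nelson" (0),
"Gibbs states Euclidean field theory DLR" (2: doi:10.2307/1970989 Guerra–Rosen–Simon 1975,
doi:10.4171/070); `lit galaxy search "uniqueness of Gibbs measure implies conformal invariance"
--star all` (0 hits; crabby saturated), `lit galaxy search "global Markov property" --star pdf` (10
hits, all graphical-models noise); `lit frontier CriticalPhenomena --since 2020` (30 rows, nothing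
DLR/Markov-for-CFT; arXiv:2604.05772 noted), `lit bridges CriticalPhenomena --cross any` (30 rows,
surveys); OpenAlex/S2/arXiv HTTP 429 all session; the card's own searches and its refuter audit
(Georgii doi:10.1515/9783110250329, FV §6.6, Aru–Powell Thm 2, Cosme et al. 2015,  [refs: 10.1007/bf01418123, 10.1007/bf01238808, 10.1007/bf01208480, 10.1007/bf01210928, 10.2307/1970989, 10.4171/070, 10.1515/9783110250329, 2103.07273, 1909.05067, 2604.05772, doi:10.1007/bf01418123, doi:10.1007/bf01238808, doi:10.1007/bf01208480, doi:10.1007/bf01210928, doi:10.2307/1970989, doi:10.4171/070, doi:10.1515/9783110250329, FriedliVelenik2017, Georgii2011, GuerraRosenSimon1975, Rockner1986, Al]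

Barriers (technique_class: dlr-uniqueness, ball-specification): - technique_class: dlr-uniqueness, ball-specification
- Literature.Barriers.CriticalPhenomena.ScaleCovarianceNotMoebius: evaded through its scope caveat
(a) — B keeps HasPointwiseScalingLimit (criticalCorr 3) and the NonCoincident normalisation and ADDS
a ball specification (Markov kernels) and a field carrier; the barrier's witness is a bare
CorrFamily (not clustering, not a field, specified by nothing). Honest residue: the inversion
content sits in (CB), for which no engine exists yet; the route does not claim otherwise.
- Literature.Barriers.CriticalPhenomena.PositionSpaceRGNonGibbsian: relevant in spirit and carried
as crux A's risk — A asserts that the LIMIT law is specified by proper germ-measurable ball kernels,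
a Gibbsianness/quasilocality claim about a scaling limit; no RG map on Hamiltonians is applied, and
the regime (h = 0, β = β_c, d = 3 < d_u) is outside the barrier's proven low-temperature
non-quasilocal region (vEFS §6.1.1: no evidence of pathologies at or above T_c below d_u), but no
theorem covers it.
- Literature.Barriers.CriticalPhenomena.LiouvilleRigidity: used positively — in d = 3 Möbius is all
there is, balls/spheres are its natural regions, Möb(3) = ⟨Sim(3), ι⟩; no planar conformal map,
discrete holomorphicity or SLE enters.
- Literature.Barriers.CriticalPhenomena.BootstrapLatticeBlindness: not met — every item quantifies
over criticalCorr 3 / isingFieldLaw / isingSpecification; Δ̂ and the Poisson form enter only the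
falsifier.
- Literature.Barriers.C

History (route lifecycle, newest last):
- 2026-08-15T16:54:27Z · rev 3: restated BallSpecifiedFieldLimit (stmt-CriticalPhenomena-5729), BallSpecifiedInversionUpgrade (stmt-CriticalPhenomena-5728) — cone repair (rrepair g2): import Literature.Probability.LatticeModels.FieldScalingLimit DROPPED → −2 unproved cone facts (Ising3DFieldScalingLimit [open problem (planner-rrepair-CriticalPhenomena-BallSpecific-6fb3cf20-g2-0)
- 2026-08-25T09:56:15Z · DORMANT — reconciler: no traction for 7.6 d (last activity item-evidence-added at 2026-08-17T19:09:53Z); parked, not closed — `ledger route dormant route-CriticalPhenomen (operator:999:2266893)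
- 2026-08-27T15:09:32Z · REACTIVATED — reconciler: reactivated — activity statement-checked at 2026-08-27T13:50:46Z after parking at 2026-08-25T09:56:15Z (operator:999:3124332)

sub-problem: Ising3DConformalLimit · status: open · opened planner-plancard-CriticalPhenomena-Ising3DCon-4a582cda-0 2026-08-15T11:42:15Z · rev 3 · ledger route-CriticalPhenomena-BallSpecification
GENERATED by the gate from the ledger (D-0016/17). Provers cite these decls: `theorem foo : Summit.CriticalPhenomena.Ising3DConformalLimit.Theses.BallSpecification.<Decl> := …` in Summits/CriticalPhenomena/Ising3DConformalLimit/Theorems/<Name>.lean.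
-/

namespace Summit.CriticalPhenomena.Ising3DConformalLimit.Theses.BallSpecification

open scoped BigOperators Topology Manifold Classical MeasureTheory ProbabilityTheory Matrix InnerProductSpace ComplexConjugate ContinuousMap
open Filter Set Function TopologicalSpace MeasureTheory

attribute [summit_statement] _root_.Ising3DConformalLimit

-- earlier BallSpecifiedInversionUpgrade (stmt-CriticalPhenomena-5728, replaced 2026-08-15T16:54:27Z -> stmt-CriticalPhenomena-11248): retired by None — ∀ (ρ : ℝ → ℝ) (Δ : ℝ) (S : Literature.Probability.LatticeModels.CorrFamily 3) (L : ℝ → ℕ) (μ : MeasureTheory.Measure (Literature.MathematicalPhysics.QuantumLattice.FieldConfig (EuclideanSpace ℝ (Fin 3)))) (γ : EuclideanSpace ℝ (Fin 3) → ℝ → Literatur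
/-- item stmt-CriticalPhenomena-11248 · crux · rank 2 · open · by planner
why it might fail: (CB) has no engine and may be as hard as inversion itself: a germ-Markov, RP, Euclidean, scale-covariant scalar field on ℝ³ that is not Möbius could exist (none known; Ising excluded only numerically, Δ_V > 5); (PU)'s a-priori class may still admit defect states at 0 / ∞.
sources: FriedliVelenik2017, Georgii2011, AruPowell2022, Rockner1986, AlbeverioHeghkrohnZegarlinski1989, DelamotteTissierWschebor2016
[crux] for every tuple (ρ, Δ, S, L, μ, γ) satisfying exactly the body of BallSpecifiedFieldLimit
(rev 2) — S a normalised (S = 0 off NonCoincident), non-degenerate, Euclidean-invariant,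
scale-covariant pointwise scaling limit of criticalCorr 3 at β_c; μ the limit in law of the smeared
critical spin fields (written out through spinFieldLaw/isingMeasure), with moment densities S,
Euclidean-invariant and scale-covariant law (written out); γ a ball specification of μ in the sense
of (B1): probability kernels, exterior-measurable, Markov across spheres (germ-measurable on
interior events), proper for every datum, IsGibbsFor γ μ univ, all for 0 < r — the family S is
inversion covariant with the same Δ (IsInversionCovariant Δ S; with Euclid ∧ scale this is
IsMoebiusCovariant Δ S). Card items (B4)+(CB)+(B2) fused into the one node they serve; intended
proof = a Sim(3)-covariant good (consistent, Feller on regular data) VERSION of the kernels + (CB)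
centre-blindness of the unit-ball kernel ⇒ local Möbius covariance of the kernel family (Möb(3) =
Sim(3)·Aut(B₁)); then ι_*μ is Gibbs for γ on every ball whose closure avoids 0 (IsGibbsFor γ (ι_*μ)
{0}ᶜ) and (PU) punctured uniqueness in the a-pr -/
@[route_item "route-CriticalPhenomena-BallSpecification", crux]
def BallSpecifiedInversionUpgrade : Prop :=
  ∀ (ρ : ℝ → ℝ) (Δ : ℝ) (S : Literature.Probability.LatticeModels.CorrFamily 3) (L : ℝ → ℕ) (μ : MeasureTheory.Measure (Literature.MathematicalPhysics.QuantumLattice.FieldConfig (EuclideanSpace ℝ (Fin 3)))) (γ : EuclideanSpace ℝ (Fin 3) → ℝ → Literature.MathematicalPhysics.QuantumLattice.FieldConfig (EuclideanSpace ℝ (Fin 3)) → MeasureTheory.Measure (Literature.MathematicalPhysics.QuantumLattice.FieldConfig (EuclideanSpace ℝ (Fin 3)))), ((∀ δ ∈ Set.Ioc (0:ℝ) 1, 0 < ρ δ) ∧ 0 < Δ ∧ Literature.Probability.LatticeModels.HasPointwiseScalingLimit (Literature.Probability.LatticeModels.criticalCorr 3) ρ S ∧ (∀ n z, z ∉ Literature.Probability.LatticeModels.NonCoincident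 3 n → S n z = 0) ∧ Literature.Probability.LatticeModels.IsNondegenerateTwoPoint S ∧ Literature.Probability.LatticeModels.IsEuclideanInvariant S ∧ Literature.Probability.LatticeModels.IsScaleCovariant Δ S ∧ Filter.Tendsto (fun δ : ℝ => δ * L δ) (nhdsWithin 0 (Set.Ioi 0)) Filter.atTop ∧ Literature.MathematicalPhysics.QuantumLattice.TendstoInLaw (fun δ => Literature.MathematicalPhysics.QuantumLattice.spinFieldLaw (Literature.Probability.LatticeModels.isingMeasure (Literature.Probability.LatticeModels.zdGraph 3) (Literature.Probability.LatticeModels.box 3 (L δ)) (Literature.Probability.LatticeModels.criticalBeta 3) 0 Literature.Probability.LatticeModels.BoundaryCondition.plus) (Literature.Probability.LatticeModels.box 3 (L δ)) δ (ρ δ)) (nhdsWithin 0 (Set.Ioi 0)) μ ∧ Literature.MathematicalPhysics.QuantumLattice.HasMomentDensity μ S ∧ Literature.MathematicalPhysics.QuantumLattice.IsEuclideanInvariantLaw μ ∧ (∀ (s : ℝ) (hs : 0 < s), MeasureTheory.Measure.map (Literature.MathematicalPhysics.QuantumLattice.FieldConfig.act ((s ^ (Δ - 3)) • Literature.MathematicalPhysics.QuantumLattice.dilateTest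 s hs.ne')) μ = μ) ∧ (∀ c r, 0 < r → ∀ η, MeasureTheory.IsProbabilityMeasure (γ c r η)) ∧ (∀ c r, 0 < r → ∀ A, MeasurableSet A → Measurable[Literature.MathematicalPhysics.QuantumLattice.extEvents (Metric.closedBall c r)ᶜ] (fun η => γ c r η A)) ∧ (∀ c r, 0 < r → ∀ A, MeasurableSet[Literature.MathematicalPhysics.QuantumLattice.extEvents (Metric.ball c r)] A → Measurable[Literature.MathematicalPhysics.QuantumLattice.germEvents c r] (fun η => γ c r η A)) ∧ (∀ c r, 0 < r → ∀ η, ∀ᵐ ω ∂(γ c r η), ∀ f : SchwartzMap (EuclideanSpace ℝ (Fin 3)) ℝ, tsupport (f : EuclideanSpace ℝ (Fin 3) → ℝ) ⊆ (Metric.closedBall c r)ᶜ → ω f = η f) ∧ Literature.MathematicalPhysics.QuantumLattice.IsGibbsFor γ μ Set.univ) → Literature.Probability.LatticeModels.IsInversionCovariant Δ S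

-- earlier BallSpecifiedFieldLimit (stmt-CriticalPhenomena-5729, replaced 2026-08-15T16:54:27Z -> stmt-CriticalPhenomena-11247): retired by None — ∃ (ρ : ℝ → ℝ) (Δ : ℝ) (S : Literature.Probability.LatticeModels.CorrFamily 3) (L : ℝ → ℕ) (μ : MeasureTheory.Measure (Literature.MathematicalPhysics.QuantumLattice.FieldConfig (EuclideanSpace ℝ (Fin 3)))) (γ : EuclideanSpace ℝ (Fin 3) → ℝ → Literature.Math
/-- item stmt-CriticalPhenomena-11247 · crux · rank 3 · open · by planner
why it might fail: Full δ→0⁺ limit (even rotation invariance of subsequential limits) is open on ℤ³ (ICM2022 §8.4); germ-Markov across spheres may fail for the σ-field alone (ε-sector data) or not survive the limit; all-η properness + exterior measurability needs a measurable selector of interior extensions.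
sources: DuminilCopinICM2022, AizenmanDuminilCopinAnnals2021, Nelson1973, AruPowell2022, GuerraRosenSimon1975, Rockner1986
[crux] there exist ρ > 0 on (0,1], Δ > 0, S, box sides L with δ·L(δ) → ∞, a law μ on FieldConfig ℝ³
and ball kernels γ : ℝ³ → ℝ → FieldConfig ℝ³ → Measure (FieldConfig ℝ³) such that:
HasPointwiseScalingLimit (criticalCorr 3) ρ S, S = 0 off NonCoincident, IsNondegenerateTwoPoint S,
IsEuclideanInvariant S, IsScaleCovariant Δ S; the smeared critical spin fields Φ_δ (= isingFieldLaw
3 β_c L δ ρ of FieldScalingLimit.lean, written out DEFINITIONALLY as spinFieldLaw (isingMeasure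
(zdGraph 3) (box 3 (L δ)) β_c 0 plus) (box 3 (L δ)) δ (ρ δ) so that FieldScalingLimit.lean and its
open facts stay out of this route's import cone) converge in law to μ as δ → 0⁺, HasMomentDensity μ
S, IsEuclideanInvariantLaw μ, and the LAW is scale covariant with dimension Δ (IsScaleCovariantLaw μ
Δ written out: μ is invariant under the transpose of f ↦ s^(Δ−3) f(·/s) for every s > 0); and (B1) μ
is SPECIFIED ON BALLS (Röckner-style; clauses of
Literature/MathematicalPhysics/QuantumLattice/BallSpecification.lean, every kernel clause guarded by
0 < r): γ c r η is a probability measure, η ↦ γ c r η A is extEvents (closedBall c r)ᶜ-measurable,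
for interior events A ∈ extEvents (ball c r) it is germEvents c r-measur -/
@[route_item "route-CriticalPhenomena-BallSpecification", crux]
def BallSpecifiedFieldLimit : Prop :=
  ∃ (ρ : ℝ → ℝ) (Δ : ℝ) (S : Literature.Probability.LatticeModels.CorrFamily 3) (L : ℝ → ℕ) (μ : MeasureTheory.Measure (Literature.MathematicalPhysics.QuantumLattice.FieldConfig (EuclideanSpace ℝ (Fin 3)))) (γ : EuclideanSpace ℝ (Fin 3) → ℝ → Literature.MathematicalPhysics.QuantumLattice.FieldConfig (EuclideanSpace ℝ (Fin 3)) → MeasureTheory.Measure (Literature.MathematicalPhysics.QuantumLattice.FieldConfig (EuclideanSpace ℝ (Fin 3)))), (∀ δ ∈ Set.Ioc (0:ℝ) 1, 0 < ρ δ) ∧ 0 < Δ ∧ Literature.Probability.LatticeModels.HasPointwiseScalingLimit (Literature.Probability.LatticeModels.criticalCorr 3) ρ S ∧ (∀ n z, z ∉ Literature.Probability.LatticeModels.NonCoincident 3 n → S n z = 0) ∧ Literature.Probability.LatticeModels.IsNondegenerateTwoPoint S ∧ Literature.Probability.LatticeModels.IsEuclideanInvariant S ∧ Literature.Probability.LatticeModels.IsScaleCovariant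 Δ S ∧ Filter.Tendsto (fun δ : ℝ => δ * L δ) (nhdsWithin 0 (Set.Ioi 0)) Filter.atTop ∧ Literature.MathematicalPhysics.QuantumLattice.TendstoInLaw (fun δ => Literature.MathematicalPhysics.QuantumLattice.spinFieldLaw (Literature.Probability.LatticeModels.isingMeasure (Literature.Probability.LatticeModels.zdGraph 3) (Literature.Probability.LatticeModels.box 3 (L δ)) (Literature.Probability.LatticeModels.criticalBeta 3) 0 Literature.Probability.LatticeModels.BoundaryCondition.plus) (Literature.Probability.LatticeModels.box 3 (L δ)) δ (ρ δ)) (nhdsWithin 0 (Set.Ioi 0)) μ ∧ Literature.MathematicalPhysics.QuantumLattice.HasMomentDensity μ S ∧ Literature.MathematicalPhysics.QuantumLattice.IsEuclideanInvariantLaw μ ∧ (∀ (s : ℝ) (hs : 0 < s), MeasureTheory.Measure.map (Literature.MathematicalPhysics.QuantumLattice.FieldConfig.act ((s ^ (Δ - 3)) • Literature.MathematicalPhysics.QuantumLattice.dilateTest s hs.ne')) μ = μ) ∧ (∀ c r, 0 < r → ∀ η, MeasureTheory.IsProbabilityMeasure (γ c r η)) ∧ (∀ c r, 0 < r → ∀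 A, MeasurableSet A → Measurable[Literature.MathematicalPhysics.QuantumLattice.extEvents (Metric.closedBall c r)ᶜ] (fun η => γ c r η A)) ∧ (∀ c r, 0 < r → ∀ A, MeasurableSet[Literature.MathematicalPhysics.QuantumLattice.extEvents (Metric.ball c r)] A → Measurable[Literature.MathematicalPhysics.QuantumLattice.germEvents c r] (fun η => γ c r η A)) ∧ (∀ c r, 0 < r → ∀ η, ∀ᵐ ω ∂(γ c r η), ∀ f : SchwartzMap (EuclideanSpace ℝ (Fin 3)) ℝ, tsupport (f : EuclideanSpace ℝ (Fin 3) → ℝ) ⊆ (Metric.closedBall c r)ᶜ → ω f = η f) ∧ Literature.MathematicalPhysics.QuantumLattice.IsGibbsFor γ μ Set.univ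

/-- item stmt-CriticalPhenomena-0636 · crux · rank 4 · open · by planner
why it might fail: No proof that U₄ ≢ 0 in d = 3: the double-current intersection probability at macroscopic separation must stay > 0 as δ → 0 (only the d ≥ 4 triviality side is a theorem: Aizenman 82, ADC 21); RP long-range models ON ℤ³ (α < 3/2) are Gaussian (LongRangeTrivialityOnZ3).
sources: AizenmanCMP1982, AizenmanDuminilCopinAnnals2021, DuminilCopinICM2022, Literature.Barriers.CriticalPhenomena.LongRangeTrivialityOnZ3, Literature.Barriers.CriticalPhenomena.IsingTrivialityFromDimensionFour
Crux r4 (non-triviality in d=3): every non-degenerate pointwise scaling limit S of the renormalised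
critical Ising correlators on Z^3 has connected four-point function U4 ≢ 0 on non-coincident
configurations. Intended tool: the random-current identity U4(x,y,z,t) =
−2⟨σxσy⟩⟨σzσt⟩·P^{xy,zt}[C_{n1+n2}(x) ∩ C_{n1+n2}(z) ≠ ∅] (Aizenman 1982; ADC2021 arXiv:1912.07973
eq. (3.11)): non-Gaussianity ⇔ the intersection probability of the two double-current clusters at
macroscopic separation does not vanish as δ → 0. Contrast: for d ≥ 4 every such limit IS Gaussian
(Literature.Probability.LatticeModels.highDim_triviality). Its negation refutes the conjunct
Ising3DConformalLimit itself. -/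
@[route_item "route-CriticalPhenomena-BallSpecification", crux]
def NonGaussianLimit : Prop :=
  ∀ (ρ : ℝ → ℝ) (S : Literature.Probability.LatticeModels.CorrFamily 3), (∀ δ ∈ Set.Ioc (0:ℝ) 1, 0 < ρ δ) → Literature.Probability.LatticeModels.HasPointwiseScalingLimit (Literature.Probability.LatticeModels.criticalCorr 3) ρ S → Literature.Probability.LatticeModels.IsNondegenerateTwoPoint S → Literature.Probability.LatticeModels.HasNontrivialU4 S

/-- item stmt-CriticalPhenomena-5730 · support · rank 9 · closed · proved by Summit.CriticalPhenomena.Ising3DConformalLimit.Theorems.latticePuncturedUniqueness_proof @ fcfb8683ccdb (prover) · by planner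
sources: FriedliVelenik2017, AizenmanDuminilCopinSidoraviciusCMP2015, Georgii2011, Literature.Probability.LatticeModels.hasUniqueGibbsMeasure_criticalBeta_holds
[support] lattice seed of the punctured-uniqueness step (PU), a special case provable now on paper:
every probability measure ν on spin configurations of ℤ³ that satisfies the DLR equations of the
critical Ising specification isingSpecification (zdGraph 3) β_c 0 for all finite volumes Λ NOT
containing the origin (the spin at 0 treated as environment — a point defect) and has ⟨σ₀⟩_ν = 0 is
a Gibbs measure for the full specification (hence THE critical state, by
hasUniqueGibbsMeasure_criticalBeta_holds). Paper proof: condition ν on σ₀ = s; ν(·|σ₀ = s) is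
punctured-Gibbs with the 0-spin frozen, FKG-sandwiched between the ∓/± limits of the kernels on box
L ∖ {0}, which are the box-L minus/plus states conditioned on the cylinder {σ₀ = s}; these converge
to μ_{β_c}(·|σ₀ = s) by uniqueness (ADS15), since conditioning on a clopen local event of
probability → 1/2 commutes with the weak limit; so ν = p μ(·|+) + (1−p) μ(·|−), and ⟨σ₀⟩_ν = 0
forces p = 1/2, ν = μ_{β_c}. "A point defect at criticality carries only its own spin." Tree inputs:
ising_fkg, hasBoxLimit_isingCorr_plus, hasUniqueGibbsMeasure_criticalBeta_holds,
isGibbsMeasure_iff_condExp. [difficulty: L] -/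
@[route_item "route-CriticalPhenomena-BallSpecification", crux]
def LatticePuncturedUniqueness : Prop :=
  ∀ ν : MeasureTheory.Measure (Literature.Probability.LatticeModels.SpinConfig (Literature.Probability.LatticeModels.Site 3)), MeasureTheory.IsProbabilityMeasure ν → (∀ Λ : Finset (Literature.Probability.LatticeModels.Site 3), (0 : Literature.Probability.LatticeModels.Site 3) ∉ Λ → ∀ A : Set (Literature.Probability.LatticeModels.SpinConfig (Literature.Probability.LatticeModels.Site 3)), MeasurableSet A → ∫⁻ η, Literature.Probability.LatticeModels.isingSpecification (Literature.Probability.LatticeModels.zdGraph 3) (Literature.Probability.LatticeModels.criticalBeta 3) 0 Λ η A ∂ν = ν A) → ∫ s, Literature.Probability.LatticeModels.spinAt (0 : Literature.Probability.LatticeModels.Site 3) s ∂ν = 0 → ν ∈ Literature.Probability.LatticeModels.isingGibbsMeasures 3 (Literature.Probability.LatticeModels.criticalBeta 3) 0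

-- `LatticePuncturedUniqueness` holds: proved by `Summit.CriticalPhenomena.Ising3DConformalLimit.Theorems.latticePuncturedUniqueness_proof` @ fcfb8683ccdb (its module imports this route file, so no `_holds` link can be stated here).

/-- item stmt-CriticalPhenomena-5731 · assembly · rank 1 · closed · proved by Summit.CriticalPhenomena.Ising3DConformalLimit.Theorems.ballSpecification_assembly_proof (prover) · by planner
sources: DuminilCopinICM2022, FriedliVelenik2017
[assembly] BallSpecifiedFieldLimit → BallSpecifiedInversionUpgrade → NonGaussianLimit →
Ising3DConformalLimit. -/
@[route_item "route-CriticalPhenomena-BallSpecification", crux]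
def Assembly : Prop :=
  BallSpecifiedFieldLimit → BallSpecifiedInversionUpgrade → NonGaussianLimit → Ising3DConformalLimit

-- `Assembly` holds: proved by `Summit.CriticalPhenomena.Ising3DConformalLimit.Theorems.ballSpecification_assembly_proof` (its module imports this route file, so no `_holds` link can be stated here).

/-! D-0027 §2.1 — DECIDING THEOREM (planner-authored via `route open/edit --closes-file`; by planner-rrepair-CriticalPhenomena-BallSpecific-6fb3cf20-g2-0 2026-08-15T16:54:27Z):
its hypotheses are this route's items and its conclusion the sub-problem Statement (glue_lint), and it elaborates with this file. -/

@[closes "route-CriticalPhenomena-BallSpecification"] theorem closes : BallSpecifiedInversionUpgrade → BallSpecifiedFieldLimit → NonGaussianLimit → LatticePuncturedUniqueness → Assembly → _root_.Ising3DConformalLimit := fun h_BallSpecifiedInversionUpgrade h_BallSpecifiedFieldLimit h_NonGaussianLimit h_LatticePuncturedUniqueness h_Assembly => h_Assembly h_BallSpecifiedFieldLimit h_BallSpecifiedInversionUpgrade h_NonGaussianLimit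

end Summit.CriticalPhenomena.Ising3DConformalLimit.Theses.BallSpecification
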